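import Literature.Computability.QuantumComplexity.QueryComplexity
import Literature.Computability.QuantumComplexity.ExactQuantumQuery
import HarnessLib

/-!
# Exact quantum simulation of deterministic decision trees: `Q_E(f) ≤ D(f)`

Buhrman–de Wolf, *Complexity measures and decision tree complexity: a survey*, Theoret. Comput.
Sci. 288 (2002), §3.3, p. 27: "Consider a `T`-query deterministic decision tree. … The basis
states of the corresponding quantum algorithm have the form `|i, b, h, a⟩`, where `i, b` is the
query-part, `h` ranges over all possible histories of the classical computation … All operations
`U_i` performed here are injective mappings from basis states to basis states, hence they can be
extended to permutations of basis states, which are unitary transformations. Thus a `T`-query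
deterministic decision tree can be simulated by an exact `T`-query quantum algorithm. …
Accordingly, we have `Q₂(f) ≤ R₂(f) ≤ D(f) ≤ n` and `Q₂(f) ≤ Q_E(f) ≤ D(f) ≤ n` for all `f`."

This file carries out that simulation in the tree's query model `QQueryAlg`
(`Cryptography/QuantumQuery.lean`) for the tree's decision trees `Complexity.DecisionTree`
(`Complexity/DecisionTree.lean`) and discharges the named fact
`quantumQueryComplexity_zero_le_detQueryComplexity` (**quantum-advantage.S09**, `Q_E(f) ≤ D(f)`)
of `QueryComplexity.lean`: `quantumQueryComplexity_zero_le_detQueryComplexity_holds`.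

Construction (`DetTreeSim.simAlg T`, for a tree `T` of depth `d`). Workspace
`W = (Fin d → Bool)`, the history `h` of the printed proof recorded as the vector of answers
received so far (the queried indices are determined by the answers, so they need not be stored).
Writing `walk T r j` for the subtree reached from the root after following the first `j` answers
of a transcript `r` (a leaf stays put, `child`) and `rootVar t` for the variable queried at the
root of `t` (an arbitrary default, `0`, at a leaf — the algorithm then makes dummy queries, so
that it always makes exactly `d` queries), the state before the `(j+1)`-st query is the basis
state `|rootVar (walk T r j), 0, r⟩` with `r` the first `j` answers padded by zeros. The query
writes the answer into the target bit; `U_{j+1}` is the permutation matrix of `stepPerm T j`: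
swap the target bit with history slot `j` (`recPerm`), then move the index register from the
old root variable to the new one by a transposition depending only on the history (`idxPerm`).
After `d` rounds the subtree reached is a leaf, labelled `T(x)` (`walk_depth_eq_leaf`), and the
algorithm accepts iff that label is `1`; all intermediate states are basis states
(`simAlg_finalState`, by the `Fin.foldl` invariant principle `foldl_invariant` of
`PolynomialMethod.lean` and `permMatrix_mulVec_single` of `ExactQuantumQuery.lean`), so the
acceptance probability is exactly `[T(x) = 1]` (`simAlg_acceptProb`) and the simulation has
error `0` with `d` queries (`simAlg_computesWithError`). Taking `T` of depth `D(f)` gives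
`Q_E(f) ≤ D(f)`; for `N = 0` both sides are `0`.

## References

* H. Buhrman, R. de Wolf, *Complexity measures and decision tree complexity: a survey*,
  Theoret. Comput. Sci. 288 (2002) 21–43, §3.3 (p. 27) [Wolf2002]
  (doi:10.1016/S0304-3975(01)00144-X).
* R. Beals, H. Buhrman, R. Cleve, M. Mosca, R. de Wolf, *Quantum lower bounds by polynomials*,
  J. ACM 48 (2001), §3 ("`Q₂(f) ≤ Q₀(f) ≤ Q_E(f) ≤ D(f) ≤ N`") [BealsEtAl2001].
-/

namespace Literature.Computability.QuantumComplexity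

open Matrix Literature.Computability.Complexity Literature.Computability.Cryptography

variable {N : ℕ}

open Classical in
/-- A query algorithm whose final state on input `x` is the basis state `|s₀⟩` accepts `x` with
probability `1` if `s₀` is accepting and `0` otherwise (Born rule on a basis state). [folklore] -/
theorem acceptProb_eq_of_finalState_eq_single (A : QQueryAlg N) (x : Fin N → Bool)
    (s₀ : Fin N × Bool × A.W) (h : A.finalState x = Pi.single s₀ 1) :
    A.acceptProb x = if s₀ ∈ A.accept then 1 else 0 := by
  unfold QQueryAlg.acceptProb
  rw [h, Finset.sum_filter, Finset.sum_eq_single s₀]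
  · simp only [Pi.single_eq_same, norm_one, one_pow]
  · intro s _ hs
    rw [Pi.single_eq_of_ne hs]
    simp
  · simp

namespace DetTreeSim

/-- One step down a decision tree along the answer `b`: the `b`-child of a query node; a leaf
stays put (the simulation keeps making dummy queries once the classical computation has
halted). [cite: Wolf2002, §3.3 p. 27] -/
def child : DecisionTree N → Bool → DecisionTree N
  | .leaf c, _ => .leaf c
  | .query _ t₀ t₁, b => if b then t₁ else t₀

/-- The variable queried at the root of a tree (`0` at a leaf: a dummy query).
[cite: Wolf2002, §3.3 p. 27] -/
def rootVar [NeZero N] : DecisionTree N → Fin N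
  | .leaf _ => 0
  | .query i _ _ => i

/-- The subtree reached from the root of `T` after following the first `j` answers of the
transcript `r : Fin d → Bool` (answers beyond the transcript count as `0`): the "history"
component of the printed simulation. [cite: Wolf2002, §3.3 p. 27] -/
def walk {d : ℕ} (T : DecisionTree N) (r : Fin d → Bool) : ℕ → DecisionTree N
  | 0 => T
  | j + 1 => child (walk T r j) (if h : j < d then r ⟨j, h⟩ else false)

variable {d : ℕ}

/-- `walk T r 0 = T`. [folklore] -/
@[simp] theorem walk_zero (T : DecisionTree N) (r : Fin d → Bool) : walk T r 0 = T := rfl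

/-- One more answer followed (unfolding lemma). [folklore] -/
theorem walk_succ (T : DecisionTree N) (r : Fin d → Bool) (j : ℕ) :
    walk T r (j + 1) = child (walk T r j) (if h : j < d then r ⟨j, h⟩ else false) := rfl

/-- One more answer followed, inside the transcript. [folklore] -/
theorem walk_succ_of_lt (T : DecisionTree N) (r : Fin d → Bool) {j : ℕ} (hj : j < d) :
    walk T r (j + 1) = child (walk T r j) (r ⟨j, hj⟩) := by
  rw [walk_succ, dif_pos hj]

/-- `walk T r j` depends only on the first `j` answers of `r`. [folklore] -/
theorem walk_congr (T : DecisionTree N) {r r' : Fin d → Bool} {j : ℕ}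
    (h : ∀ k : Fin d, k.val < j → r k = r' k) : walk T r j = walk T r' j := by
  induction j with
  | zero => rfl
  | succ j ih =>
    rw [walk_succ, walk_succ, ih fun k hk => h k (Nat.lt_succ_of_lt hk)]
    congr 1
    by_cases hj : j < d
    · rw [dif_pos hj, dif_pos hj]
      exact h _ (Nat.lt_succ_self j)
    · rw [dif_neg hj, dif_neg hj]

/-- Writing history slot `j` does not change the first `j` steps of the walk. [folklore] -/
theorem walk_update (T : DecisionTree N) (r : Fin d → Bool) (j : Fin d) (b : Bool) :
    walk T (Function.update r j b) j = walk T r j :=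
  walk_congr T fun _ hk => Function.update_of_ne (Fin.ne_of_val_ne (Nat.ne_of_lt hk)) b r

/-- Following the true answer at the root does not change the value computed on `x`.
[cite: Wolf2002, §3.3 p. 27] -/
theorem eval_child_rootVar [NeZero N] (t : DecisionTree N) (x : Fin N → Bool) :
    (child t (x (rootVar t))).eval x = t.eval x := by
  cases t with
  | leaf c => rfl
  | query i t₀ t₁ => cases hx : x i <;> simp [child, rootVar, hx]

/-- A child is shallower by one (a leaf has depth `0`). [folklore] -/
theorem depth_child_le (t : DecisionTree N) (b : Bool) : (child t b).depth ≤ t.depth - 1 := by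
  cases t with
  | leaf c => simp [child]
  | query i t₀ t₁ => cases b <;> simp [child]

/-- After `j` steps the remaining subtree has depth at most `depth T - j`. [folklore] -/
theorem depth_walk_le (T : DecisionTree N) (r : Fin d → Bool) (j : ℕ) :
    (walk T r j).depth ≤ T.depth - j := by
  induction j with
  | zero => simp
  | succ j ih =>
    rw [walk_succ]
    exact (depth_child_le _ _).trans (by omega)

/-- After `depth T` steps the walk has reached a leaf, whose label is then the value it computes.
[cite: Wolf2002, §3.3 p. 27] -/
theorem walk_depth_eq_leaf (T : DecisionTree N) (r : Fin T.depth → Bool) (x : Fin N → Bool) :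
    walk T r T.depth = .leaf ((walk T r T.depth).eval x) := by
  have h0 := depth_walk_le T r T.depth
  rw [Nat.sub_self, Nat.le_zero] at h0
  cases hw : walk T r T.depth with
  | leaf c => rfl
  | query i t₀ t₁ => simp [hw] at h0

/-- `recPerm j`: swap the target bit with history slot `j`, `(i, b, r) ↦ (i, r j, r[j := b])`
(an involution of the computational basis). [cite: Wolf2002, §3.3 p. 27] -/
def recPerm (j : Fin d) : Equiv.Perm (Fin N × Bool × (Fin d → Bool)) where
  toFun s := (s.1, s.2.2 j, Function.update s.2.2 j s.2.1)
  invFun s := (s.1, s.2.2 j, Function.update s.2.2 j s.2.1)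
  left_inv := by
    rintro ⟨i, b, r⟩
    simp
  right_inv := by
    rintro ⟨i, b, r⟩
    simp

/-- Unfolding lemma for `recPerm`. [folklore] -/
@[simp] theorem recPerm_apply (j : Fin d) (s : Fin N × Bool × (Fin d → Bool)) :
    recPerm j s = (s.1, s.2.2 j, Function.update s.2.2 j s.2.1) := rfl

/-- `idxPerm T j`: move the index register from the variable queried at step `j` to the one
queried at step `j + 1`, by the transposition of the two (which depends only on the history
register); an involution of the computational basis. [cite: Wolf2002, §3.3 p. 27] -/
def idxPerm [NeZero N] (T : DecisionTree N) (j : ℕ) :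
    Equiv.Perm (Fin N × Bool × (Fin d → Bool)) where
  toFun s := (Equiv.swap (rootVar (walk T s.2.2 j)) (rootVar (walk T s.2.2 (j + 1))) s.1, s.2)
  invFun s := (Equiv.swap (rootVar (walk T s.2.2 j)) (rootVar (walk T s.2.2 (j + 1))) s.1, s.2)
  left_inv := by
    rintro ⟨i, b, r⟩
    simp [Equiv.swap_apply_self]
  right_inv := by
    rintro ⟨i, b, r⟩
    simp [Equiv.swap_apply_self]

/-- Unfolding lemma for `idxPerm`. [folklore] -/
@[simp] theorem idxPerm_apply [NeZero N] (T : DecisionTree N) (j : ℕ)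
    (s : Fin N × Bool × (Fin d → Bool)) :
    idxPerm T j s =
      (Equiv.swap (rootVar (walk T s.2.2 j)) (rootVar (walk T s.2.2 (j + 1))) s.1, s.2) := rfl

/-- The bookkeeping permutation `U_{j+1}` of the simulation: record the answer, clear the target
bit, and set up the next query ("maps `|i, x_i, 0̃, 0⟩` to `|j, 0, h, 0⟩`, where `h` is the new
history"). [cite: Wolf2002, §3.3 p. 27] -/
def stepPerm [NeZero N] (T : DecisionTree N) (j : Fin d) :
    Equiv.Perm (Fin N × Bool × (Fin d → Bool)) :=
  (recPerm j).trans (idxPerm T j)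

/-- Unfolding lemma for `stepPerm`. [folklore] -/
theorem stepPerm_apply [NeZero N] (T : DecisionTree N) (j : Fin d)
    (s : Fin N × Bool × (Fin d → Bool)) :
    stepPerm T j s =
      (Equiv.swap (rootVar (walk T (Function.update s.2.2 j s.2.1) j))
          (rootVar (walk T (Function.update s.2.2 j s.2.1) (j + 1))) s.1,
        s.2.2 j, Function.update s.2.2 j s.2.1) := rfl

/-- The exact `depth T`-query quantum simulation of the decision tree `T`
(Buhrman–de Wolf 2002, §3.3): workspace = answer history, `U_0 = 1`, `U_{j+1}` the permutation
matrix of `stepPerm T j`, start `|rootVar T, 0, 0̃⟩`, accept iff the leaf reached is labelled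
`1`. Reducible, so that the fields unfold in instance search. [cite: Wolf2002, §3.3 p. 27] -/
@[reducible] noncomputable def simAlg [NeZero N] (T : DecisionTree N) : QQueryAlg N where
  W := Fin T.depth → Bool
  queries := T.depth
  unitaries := Fin.cons 1 fun j =>
    ⟨((stepPerm T j)⁻¹).permMatrix ℂ, permMatrix_mem_unitaryGroup _⟩
  start := (rootVar T, false, fun _ => false)
  accept := {s | walk T s.2.2 T.depth = .leaf true}

/-- `simAlg T` makes `depth T` queries. [cite: Wolf2002, §3.3 p. 27] -/
@[simp] theorem simAlg_queries [NeZero N] (T : DecisionTree N) : (simAlg T).queries = T.depth :=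
  rfl

/-- The simulation stays in the computational basis: on input `x` the final state of `simAlg T`
is the basis state `|rootVar (leaf), 0, r⟩` for a history `r` whose walk ends at a subtree
computing `T(x)`. [cite: Wolf2002, §3.3 p. 27] -/
theorem simAlg_finalState [NeZero N] (T : DecisionTree N) (x : Fin N → Bool) :
    ∃ r : Fin T.depth → Bool, (walk T r T.depth).eval x = T.eval x ∧
      (simAlg T).finalState x = Pi.single (rootVar (walk T r T.depth), false, r) 1 := by
  have key : ∃ r : Fin T.depth → Bool, (∀ k : Fin T.depth, (simAlg T).queries ≤ k.val → r k = false) ∧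
      (walk T r (simAlg T).queries).eval x = T.eval x ∧
      (simAlg T).finalState x = Pi.single (rootVar (walk T r (simAlg T).queries), false, r) 1 := by
    unfold QQueryAlg.finalState
    refine foldl_invariant (P := fun (j : ℕ) (ψ : Fin N × Bool × (Fin T.depth → Bool) → ℂ) =>
        ∃ r : Fin T.depth → Bool, (∀ k : Fin T.depth, j ≤ k.val → r k = false) ∧
          (walk T r j).eval x = T.eval x ∧ ψ = Pi.single (rootVar (walk T r j), false, r) 1)
      (simAlg T).queries
      (fun ψ j => ((simAlg T).unitaries j.succ).1 *ᵥ (queryOracle x *ᵥ ψ))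
      (((simAlg T).unitaries 0).1 *ᵥ Pi.single (simAlg T).start 1) ?_ ?_
    · refine ⟨fun _ => false, fun _ _ => rfl, rfl, ?_⟩
      show ((simAlg T).unitaries 0).1 *ᵥ Pi.single (simAlg T).start 1 = _
      simp only [simAlg, Fin.cons_zero, Submonoid.coe_one, Matrix.one_mulVec, walk_zero]
    · rintro j ψ ⟨r, hr, hev, rfl⟩
      have hrj : r j = false := hr j le_rfl
      refine ⟨Function.update r j (x (rootVar (walk T r j))), fun k hk => ?_, ?_, ?_⟩
      · have hkj : k ≠ j := by
          rintro rfl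
          omega
        rw [Function.update_of_ne hkj]
        exact hr k (by omega)
      · rw [walk_succ_of_lt T _ j.isLt, Fin.eta, Function.update_self, walk_update,
          eval_child_rootVar, hev]
      · show ((simAlg T).unitaries j.succ).1 *ᵥ (queryOracle x *ᵥ _) = _
        simp only [simAlg, Fin.cons_succ, queryOracle, permMatrix_mulVec_single]
        rw [← Equiv.Perm.inv_def, ← Equiv.Perm.inv_def, queryPerm_inv, inv_inv, queryPerm_apply,
          queryMap_apply, stepPerm_apply]
        simp only [Bool.false_xor, hrj, walk_update, Equiv.swap_apply_left]
  obtain ⟨r, -, hev, hψ⟩ := key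
  exact ⟨r, hev, hψ⟩

/-- `simAlg T` accepts `x` with probability `1` if `T(x) = 1` and `0` otherwise.
[cite: Wolf2002, §3.3 p. 27] -/
theorem simAlg_acceptProb [NeZero N] (T : DecisionTree N) (x : Fin N → Bool) :
    (simAlg T).acceptProb x = if T.eval x = true then 1 else 0 := by
  classical
  obtain ⟨r, hev, hψ⟩ := simAlg_finalState T x
  rw [acceptProb_eq_of_finalState_eq_single (simAlg T) x _ hψ]
  have hleaf := walk_depth_eq_leaf T r x
  rw [hev] at hleaf
  simp only [simAlg, Set.mem_setOf_eq, hleaf, DecisionTree.leaf.injEq]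

/-- The simulation is exact: `simAlg T` computes the function computed by `T` with error `0`,
using `depth T` queries ("a `T`-query deterministic decision tree can be simulated by an exact
`T`-query quantum algorithm"). [cite: Wolf2002, §3.3 p. 27] -/
theorem simAlg_computesWithError [NeZero N] (T : DecisionTree N) {f : (Fin N → Bool) → Bool}
    (hT : T.Computes f) : (simAlg T).ComputesWithError 0 Set.univ f := by
  intro x _
  rw [simAlg_acceptProb, hT x]
  constructor <;> intro hx <;> simp [hx]

end DetTreeSim

/-- Every decision tree of depth `d` computing `f` yields an exact `d`-query quantum algorithm
for `f` (Buhrman–de Wolf 2002, §3.3). [cite: Wolf2002, §3.3 p. 27] -/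
theorem exists_computesWithError_zero_of_computes [NeZero N] (T : DecisionTree N)
    {f : (Fin N → Bool) → Bool} (hT : T.Computes f) :
    ∃ A : QQueryAlg N, A.queries = T.depth ∧ A.ComputesWithError 0 Set.univ f :=
  ⟨DetTreeSim.simAlg T, rfl, DetTreeSim.simAlg_computesWithError T hT⟩

/-- `Q_E(f) ≤ depth T` for every decision tree `T` computing `f`. [cite: Wolf2002, §3.3 p. 27] -/
theorem quantumQueryComplexity_zero_le_depth (T : DecisionTree N) {f : (Fin N → Bool) → Bool}
    (hT : T.Computes f) : quantumQueryComplexity 0 f ≤ T.depth := by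
  unfold quantumQueryComplexity
  rcases Nat.eq_zero_or_pos N with rfl | hN
  · rw [quantumQueryComplexityOn_zero_left]
    exact Nat.zero_le _
  · haveI : NeZero N := NeZero.of_pos hN
    exact Nat.sInf_le (exists_computesWithError_zero_of_computes T hT)

/-- **quantum-advantage.S09, `Q_E(f) ≤ D(f)`, discharged** (Buhrman–de Wolf 2002, §3.3, p. 27:
"a `T`-query deterministic decision tree can be simulated by an exact `T`-query quantum
algorithm … `Q₂(f) ≤ Q_E(f) ≤ D(f) ≤ n`"): the named fact
`quantumQueryComplexity_zero_le_detQueryComplexity` holds — exact quantum query complexity is at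
most deterministic query complexity, for every total Boolean function on `N` bits (all `N`; for
`N = 0` both sides vanish). [cite: Wolf2002, §3.3 p. 27] -/
theorem quantumQueryComplexity_zero_le_detQueryComplexity_holds :
    quantumQueryComplexity_zero_le_detQueryComplexity (N := N) := by
  intro f
  obtain ⟨T, hd, hT⟩ := exists_depth_eq_detQueryComplexity f
  rw [← hd]
  exact quantumQueryComplexity_zero_le_depth T hT

/-- The chain `Q₂(f) ≤ Q_E(f) ≤ D(f)` (Buhrman–de Wolf 2002, §3.3): bounded-error quantum query
complexity is at most deterministic query complexity, unconditionally (the named fact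
`quantumQueryComplexity_le_detQueryComplexity` of `QueryComplexity.lean`, discharged via
`quantumQueryComplexity_anti_holds` and `Q_E(f) ≤ D(f)`). [cite: Wolf2002, §3.3 p. 27] -/
theorem quantumQueryComplexity_le_detQueryComplexity_holds :
    quantumQueryComplexity_le_detQueryComplexity (N := N) := fun f =>
  (quantumQueryComplexity_anti_holds le_rfl (by norm_num) f).trans
    (quantumQueryComplexity_zero_le_detQueryComplexity_holds f)

end Literature.Computability.QuantumComplexity
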